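import Summits.ResolutionOfSingularities.ResolutionOfSingularities.Theorems.WeightedInvariantIota3CriticalInFormTools
import HarnessLib

/-!
# LEMMA C of the residue hres₃, FIRST CASE: the two flags have DIFFERENT tangent planes (`β̄ = 0`)
# (door `HypersurfaceCentreConstruction`, stmt-ResolutionOfSingularities-19897; gap list `keyRungGrHomLE_three_of_lemmaC`)

Helper for `stub_keyRungGrHomLE_three` (def-free, `--supports 19897`).  LEMMA C (hypothesis `hC` of `keyRungGrHomLE_three_of_lemmaC`,
…Iota3ResidueOfLemmaC; memo RESIDUE-PLAN.md §3) is a statement about polynomials over a field `κ` in `X₀, X₁, X₂` with the critical weights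
`(r₂, j r₂, j r₁)`.  Here: the SHAPES forced by the weights — `η = ē X₀^j + β̄ X₁` (`eta_shape`), `ζ = λ̄ X₂ + θ` with `θ ∈ κ[X₀, X₁]`
(`zeta_shape`) — and **LEMMA C IN THE CASE `β̄ = η.coeff X₁ = 0`** (`lemmaC_of_coeff_X₁_eq_zero`): killing `X₀` (which `Φ` does not contain)
turns `Φ = Σ θ_e η^{e₁} ζ^{e₂}` into `Φ = θ_{(0,0,ν)} (λ̄ X₂ + t X₁^ρ)^ν`, a solvable form.  Geometrically: if the second flag's tangent plane differs
from the first's (`β̄ = 0` happens exactly when `j = 1` and `in(g₂') ∉ κV`), the first face is a `ν`-th power — which LEMMA B forbids upstream.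
What remains of LEMMA C after this file: the case `β̄ ≠ 0` (same tangent plane; functional equation + Hasse derivatives, RESIDUE-PLAN.md §3).
[OURS · L1 W4.3 · (o70-b)/(Δ12); AI work, weaker than expert review; nothing here is a statement of the manuscript under review.]
-/

noncomputable section

open MvPolynomial

set_option linter.dupNamespace false -- mandated namespace of this single-conjunct summit

namespace Summit.ResolutionOfSingularities.ResolutionOfSingularities.Cruxes.HypersurfaceCentreConstruction.LocalEngine

namespace Iota3

namespace LemmaC

variable {κ : Type} [Field κ]

/-- The weight of an exponent for the critical weights `(r₂, j r₂, j r₁)`. [folklore] -/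
theorem weight_eq (r₁ r₂ j : ℕ) (e : Fin 3 →₀ ℕ) :
    Finsupp.weight (![r₂, j * r₂, j * r₁] : Fin 3 → ℕ) e = r₂ * e 0 + j * r₂ * e 1 + j * r₁ * e 2 := by
  rw [Finsupp.weight_apply, Finsupp.sum_fintype _ _ (by simp)]
  simp [smul_eq_mul, mul_comm, Fin.sum_univ_three]

/-- A weight-`j r₁` exponent is `X₂` or has no `X₂` (`0 < r₂`, `1 ≤ j`). [folklore] -/
theorem exponent_of_weight_critical₁ {r₁ r₂ j : ℕ} (hr₂ : 0 < r₂) (hr : r₂ < r₁) (hj : 1 ≤ j) {d : Fin 3 →₀ ℕ}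
    (hd : r₂ * d 0 + j * r₂ * d 1 + j * r₁ * d 2 = j * r₁) : d 2 = 0 ∨ d = Finsupp.single 2 1 := by
  rcases Nat.eq_zero_or_pos (d 2) with h2 | h2
  · exact Or.inl h2
  · right
    have hjr : 0 < j * r₁ := Nat.mul_pos hj (lt_trans hr₂ hr)
    have hd2 : d 2 = 1 := by
      by_contra hne
      have h2' : 2 ≤ d 2 := by omega
      have := Nat.mul_le_mul_left (j * r₁) h2'
      omega
    rw [hd2, mul_one] at hd
    have h0 : r₂ * d 0 = 0 := by omega
    have h1 : j * r₂ * d 1 = 0 := by omega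
    have hd0 : d 0 = 0 := (Nat.mul_eq_zero.mp h0).resolve_left (by omega)
    have hd1 : d 1 = 0 := (Nat.mul_eq_zero.mp h1).resolve_left (Nat.mul_pos hj hr₂).ne'
    ext i; fin_cases i <;> simp [hd0, hd1, hd2]

/-- **Shape of `η`**: a weighted-homogeneous polynomial of degree `j r₂` is `ē X₀^j + β̄ X₁`. [folklore] -/
theorem eta_shape {r₁ r₂ j : ℕ} (hr₂ : 0 < r₂) (hr : r₂ < r₁) (hj : 1 ≤ j) {η : MvPolynomial (Fin 3) κ}
    (hη : η.IsWeightedHomogeneous (![r₂, j * r₂, j * r₁] : Fin 3 → ℕ) (j * r₂)) :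
    η = C (η.coeff (Finsupp.single 0 j)) * X 0 ^ j + C (η.coeff (Finsupp.single 1 1)) * X 1 := by
  classical
  have hne : (Finsupp.single 0 j : Fin 3 →₀ ℕ) ≠ Finsupp.single 1 1 := by
    intro h
    have := Finsupp.ext_iff.mp h 1
    simp at this
  ext d
  rw [coeff_add, coeff_C_mul, coeff_C_mul, coeff_X_pow, coeff_X]
  by_cases hd : η.coeff d = 0
  · rw [hd]
    split_ifs with h1 h2 h2
    · exact absurd (h1.trans h2.symm) hne
    · rw [← h1] at hd; rw [hd]; ring
    · rw [← h2] at hd; rw [hd]; ring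
    · ring
  · have hwd := hη hd
    rw [weight_eq] at hwd
    rcases exponent_of_weight_critical₂ hr₂ hr hj hwd with h | h <;> subst h
    · rw [if_pos rfl, if_neg hne.symm]; ring
    · rw [if_neg hne, if_pos rfl]; ring

/-- **Shape of `ζ`**: a weighted-homogeneous polynomial of degree `j r₁` is `λ̄ X₂ + θ` with `θ` free of `X₂`. [folklore] -/
theorem zeta_shape {r₁ r₂ j : ℕ} (hr₂ : 0 < r₂) (hr : r₂ < r₁) (hj : 1 ≤ j) {ζ : MvPolynomial (Fin 3) κ}
    (hζ : ζ.IsWeightedHomogeneous (![r₂, j * r₂, j * r₁] : Fin 3 → ℕ) (j * r₁)) :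
    ∀ d ∈ (ζ - C (ζ.coeff (Finsupp.single 2 1)) * X 2).support, d 2 = 0 ∧ r₂ * d 0 + j * r₂ * d 1 = j * r₁ := by
  classical
  intro d hd
  rw [mem_support_iff, coeff_sub, coeff_C_mul, coeff_X] at hd
  by_cases hζd : ζ.coeff d = 0
  · by_cases h : Finsupp.single 2 1 = d
    · rw [← h] at hζd
      rw [← h, hζd, if_pos rfl] at hd
      simp at hd
    · rw [hζd, if_neg h] at hd
      simp at hd
  · have hwd := hζ hζd
    rw [weight_eq] at hwd
    rcases exponent_of_weight_critical₁ hr₂ hr hj hwd with h2 | h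
    · refine ⟨h2, ?_⟩
      rw [h2, mul_zero, add_zero] at hwd
      exact hwd
    · subst h
      rw [if_pos rfl, mul_one, sub_self] at hd
      exact absurd rfl hd

/-- Killing `X₀`: the substitution `X₀ ↦ 0`, `X₁ ↦ X₁`, `X₂ ↦ X₂` fixes every polynomial free of `X₀`. [folklore] -/
theorem aeval_killX₀_eq_self {P : MvPolynomial (Fin 3) κ} (hP : ∀ e ∈ P.support, e 0 = 0) :
    aeval (fun i : Fin 3 => if i = 0 then (0 : MvPolynomial (Fin 3) κ) else X i) P = P := by
  classical
  have key : ∀ e ∈ P.support, aeval (fun i : Fin 3 => if i = 0 then (0 : MvPolynomial (Fin 3) κ) else X i)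
      (monomial e (P.coeff e)) = monomial e (P.coeff e) := by
    intro e he
    rw [aeval_monomial, Finsupp.prod_fintype _ _ (by simp), Fin.prod_univ_three, algebraMap_eq]
    simp only [Fin.isValue, if_true, show (1 : Fin 3) ≠ 0 by decide, show (2 : Fin 3) ≠ 0 by decide, if_false,
      hP e he, pow_zero, one_mul]
    rw [monomial_eq, Finsupp.prod_fintype _ _ (by simp), Fin.prod_univ_three, hP e he, pow_zero, one_mul]
  calc aeval (fun i : Fin 3 => if i = 0 then (0 : MvPolynomial (Fin 3) κ) else X i) P
      = aeval (fun i : Fin 3 => if i = 0 then (0 : MvPolynomial (Fin 3) κ) else X i)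
          (∑ e ∈ P.support, monomial e (P.coeff e)) := by rw [← P.as_sum]
    _ = ∑ e ∈ P.support, aeval (fun i : Fin 3 => if i = 0 then (0 : MvPolynomial (Fin 3) κ) else X i)
          (monomial e (P.coeff e)) := map_sum _ _ _
    _ = ∑ e ∈ P.support, monomial e (P.coeff e) := Finset.sum_congr rfl key
    _ = P := P.as_sum.symm

/-- **LEMMA C, CASE `β̄ = 0`** (the two tangent planes differ): with the hypotheses of LEMMA C and `η.coeff X₁ = 0`,
`Φ = u (X₂ − a X₁^{r₁/r₂})^ν` with `a ≠ 0` only if `r₂ ∣ r₁`. [OURS · L1 W4.3 · (o70-b)/(Δ12)] -/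
theorem lemmaC_of_coeff_X₁_eq_zero {r₁ r₂ j ν : ℕ} (hr₂ : 0 < r₂) (hr : r₂ < r₁) (hj : 1 ≤ j) (hν : 1 ≤ ν)
    {Φ η ζ : MvPolynomial (Fin 3) κ} {s : Finset (Fin 3 →₀ ℕ)} {θ : (Fin 3 →₀ ℕ) → κ}
    (hΦ : ∀ e ∈ Φ.support, e 0 = 0 ∧ r₁ * e 2 + r₂ * e 1 = r₁ * ν) (hΦν : Φ.coeff (Finsupp.single 2 ν) ≠ 0)
    (hηhom : η.IsWeightedHomogeneous (![r₂, j * r₂, j * r₁] : Fin 3 → ℕ) (j * r₂))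
    (hζhom : ζ.IsWeightedHomogeneous (![r₂, j * r₂, j * r₁] : Fin 3 → ℕ) (j * r₁))
    (hs : ∀ e ∈ s, e 0 = 0 ∧ r₁ * e 2 + r₂ * e 1 = r₁ * ν) (hΦeq : Φ = ∑ e ∈ s, C (θ e) * (η ^ (e 1) * ζ ^ (e 2)))
    (hβ : η.coeff (Finsupp.single 1 1) = 0) :
    ∃ u a : κ, Φ = C u * (X 2 - C a * X 1 ^ (r₁ / r₂)) ^ ν ∧ (a ≠ 0 → r₂ ∣ r₁) := by
  classical
  -- the substitution killing `X₀`
  set φ₀ : MvPolynomial (Fin 3) κ →ₐ[κ] MvPolynomial (Fin 3) κ :=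
    aeval (fun i : Fin 3 => if i = 0 then (0 : MvPolynomial (Fin 3) κ) else X i) with hφ₀
  have hφX0 : φ₀ (X 0) = 0 := by rw [hφ₀, aeval_X]; simp
  have hφX1 : φ₀ (X 1) = X 1 := by rw [hφ₀, aeval_X]; simp
  have hφX2 : φ₀ (X 2) = X 2 := by rw [hφ₀, aeval_X]; simp
  -- `φ₀ η = 0`
  have hη0 : φ₀ η = 0 := by
    rw [eta_shape hr₂ hr hj hηhom, hβ, map_zero, zero_mul, add_zero, map_mul, map_pow, hφX0, zero_pow (by omega), mul_zero]
  -- `φ₀ ζ = λ̄ X₂ + t X₁^ρ`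
  set lam := ζ.coeff (Finsupp.single 2 1) with hlam
  set θζ := ζ - C lam * X 2 with hθζ
  have hθζsupp := zeta_shape hr₂ hr hj hζhom
  set t : κ := if r₂ ∣ r₁ then θζ.coeff (Finsupp.single 1 (r₁ / r₂)) else 0 with ht
  have hθ0 : φ₀ θζ = C t * X 1 ^ (r₁ / r₂) := by
    rw [θζ.as_sum, map_sum]
    have key : ∀ e ∈ θζ.support, φ₀ (monomial e (θζ.coeff e)) =
        if e = Finsupp.single 1 (r₁ / r₂) ∧ r₂ ∣ r₁ then C (θζ.coeff e) * X 1 ^ (r₁ / r₂) else 0 := by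
      intro e he
      obtain ⟨he2, hwe⟩ := hθζsupp e he
      rw [hφ₀, aeval_monomial, Finsupp.prod_fintype _ _ (by simp), Fin.prod_univ_three, algebraMap_eq]
      simp only [Fin.isValue, if_true, show (1 : Fin 3) ≠ 0 by decide, show (2 : Fin 3) ≠ 0 by decide, if_false, he2, pow_zero,
        mul_one]
      rcases Nat.eq_zero_or_pos (e 0) with h0 | h0
      · rw [h0, pow_zero, one_mul]
        rw [h0, mul_zero, zero_add] at hwe
        have hdiv : r₂ ∣ r₁ := by
          refine ⟨e 1, ?_⟩
          have : j * (r₂ * e 1) = j * r₁ := by rw [← hwe]; ring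
          exact (Nat.eq_of_mul_eq_mul_left hj this).symm
        have he1 : e 1 = r₁ / r₂ := by
          obtain ⟨k, hk⟩ := hdiv
          rw [hk, Nat.mul_div_cancel_left _ hr₂]
          have : j * r₂ * e 1 = j * r₂ * k := by rw [hwe, hk]; ring
          exact Nat.eq_of_mul_eq_mul_left (Nat.mul_pos hj hr₂) this
        have hee : e = Finsupp.single 1 (r₁ / r₂) := by
          ext i; fin_cases i <;> simp [h0, he1, he2]
        rw [if_pos ⟨hee, hdiv⟩, ← he1]
      · rw [zero_pow (by omega), zero_mul, mul_zero]
        rw [if_neg]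
        rintro ⟨hee, -⟩
        rw [hee] at h0
        simp at h0
    rw [Finset.sum_congr rfl key]
    by_cases hdiv : r₂ ∣ r₁
    · by_cases hmem : Finsupp.single 1 (r₁ / r₂) ∈ θζ.support
      · rw [Finset.sum_ite, Finset.sum_const_zero, add_zero]
        have hfilter : θζ.support.filter (fun e => e = Finsupp.single 1 (r₁ / r₂) ∧ r₂ ∣ r₁) = {Finsupp.single 1 (r₁ / r₂)} := by
          ext e
          simp only [Finset.mem_filter, Finset.mem_singleton]
          constructor
          · rintro ⟨-, h, -⟩; exact h
          · intro h; exact ⟨h ▸ hmem, h, hdiv⟩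
        rw [hfilter, Finset.sum_singleton, ht, if_pos hdiv]
      · rw [Finset.sum_eq_zero]
        · rw [ht, if_pos hdiv, notMem_support_iff.mp hmem, map_zero, zero_mul]
        · intro e he
          rw [if_neg]
          rintro ⟨h, -⟩
          exact hmem (h ▸ he)
    · rw [Finset.sum_eq_zero]
      · rw [ht, if_neg hdiv, map_zero, zero_mul]
      · intro e _
        rw [if_neg]
        rintro ⟨-, h⟩
        exact hdiv h
  have hζ0 : φ₀ ζ = C lam * X 2 + C t * X 1 ^ (r₁ / r₂) := by
    have : ζ = C lam * X 2 + θζ := by rw [hθζ]; ring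
    rw [this, map_add, map_mul, hφX2, hθ0]
    congr 1
    rw [hφ₀, aeval_C, algebraMap_eq]
  -- `Φ = φ₀ Φ = θ_{(0,0,ν)} (φ₀ ζ)^ν`
  have hΦfix : φ₀ Φ = Φ := aeval_killX₀_eq_self fun e he => (hΦ e he).1
  set u₀ : κ := if Finsupp.single 2 ν ∈ s then θ (Finsupp.single 2 ν) else 0 with hu₀
  have hΦ0 : Φ = C u₀ * (C lam * X 2 + C t * X 1 ^ (r₁ / r₂)) ^ ν := by
    rw [← hΦfix, hΦeq, map_sum]
    have key : ∀ e ∈ s, φ₀ (C (θ e) * (η ^ (e 1) * ζ ^ (e 2))) =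
        if e = Finsupp.single 2 ν then C (θ e) * (C lam * X 2 + C t * X 1 ^ (r₁ / r₂)) ^ ν else 0 := by
      intro e he
      obtain ⟨he0, hp⟩ := hs e he
      rw [map_mul, map_mul, map_pow, map_pow, hη0, hζ0, hφ₀, aeval_C, algebraMap_eq]
      rcases Nat.eq_zero_or_pos (e 1) with h1 | h1
      · rw [h1, pow_zero, one_mul]
        rw [h1, mul_zero, add_zero] at hp
        have he2 : e 2 = ν := Nat.eq_of_mul_eq_mul_left (lt_trans hr₂ hr) hp
        have hee : e = Finsupp.single 2 ν := by ext i; fin_cases i <;> simp [he0, h1, he2]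
        rw [if_pos hee, he2]
      · rw [zero_pow (by omega), zero_mul, mul_zero, if_neg]
        intro hee
        rw [hee] at h1
        simp at h1
    rw [Finset.sum_congr rfl key, Finset.sum_ite_eq' s (Finsupp.single 2 ν), hu₀]
    split_ifs with h
    · rfl
    · rw [map_zero, zero_mul]
  -- `λ̄ ≠ 0` from `X₂^ν ∈ supp Φ`
  have hlam0 : lam ≠ 0 := by
    intro h0
    apply hΦν
    rw [hΦ0, h0, map_zero, zero_mul, zero_add, mul_pow, ← map_pow, ← pow_mul, ← mul_assoc, ← map_mul, coeff_C_mul,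
      coeff_X_pow, if_neg, mul_zero]
    intro h
    have := Finsupp.ext_iff.mp h 2
    simp at this
    omega
  -- conclusion
  refine ⟨u₀ * lam ^ ν, -(t * lam⁻¹), ?_, ?_⟩
  · rw [hΦ0]
    have h1 : (C lam * C (-(t * lam⁻¹)) : MvPolynomial (Fin 3) κ) = -C t := by
      rw [← map_mul, ← map_neg]
      congr 1
      field_simp
    have key : (C lam * (X 2 - C (-(t * lam⁻¹)) * X 1 ^ (r₁ / r₂)) : MvPolynomial (Fin 3) κ) =
        C lam * X 2 + C t * X 1 ^ (r₁ / r₂) := by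
      rw [mul_sub, ← mul_assoc, h1]; ring
    calc (C u₀ * (C lam * X 2 + C t * X 1 ^ (r₁ / r₂)) ^ ν : MvPolynomial (Fin 3) κ)
        = C u₀ * (C lam * (X 2 - C (-(t * lam⁻¹)) * X 1 ^ (r₁ / r₂))) ^ ν := by rw [key]
      _ = C (u₀ * lam ^ ν) * (X 2 - C (-(t * lam⁻¹)) * X 1 ^ (r₁ / r₂)) ^ ν := by
          rw [mul_pow, ← map_pow, ← mul_assoc, ← map_mul]
  · intro ha
    by_contra hdiv
    apply ha
    rw [ht, if_neg hdiv, zero_mul, neg_zero]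

end LemmaC

end Iota3

end Summit.ResolutionOfSingularities.ResolutionOfSingularities.Cruxes.HypersurfaceCentreConstruction.LocalEngine

end
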